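import Summits.HodgeConjecture.CorCM.GaloisIndexTwoDoubledTypes
import Summits.HodgeConjecture.CorCM.GaloisTwoHalvesCyclicFibres
import Mathlib.GroupTheory.SpecificGroups.Dihedral
import HarnessLib

/-!
# The EASY half of the index-two dichotomy, ALL DEGREES: `c ∉ ⟨x²⟩` and `x` non-central on `A ⊇ C_n` (`n ≥ 3`) ⟹ BAD — no half-hunting

COR-CM (cell `pub-hodgecm2`), binder seat b04 (gen 30), count-neutral own lane «Galois-CM-type classification» (which Galois CM
fields `(G, c)` have ALL primitive CM types nondegenerate = GOOD, vs. a primitive degenerate type = BAD).  KERNEL ONLY: theorems;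
no definition, no named fact, no `sorry`.  `HC_CM` is neither used nor claimed.

SETTING (`CorCM/GaloisIndexTwoDoubledTypes`).  `G₀ = i(A) ⊔ i(A)x`, `A` abelian of index two, `θ = conj_x` on `A`, `x² = i(q)`,
complex conjugation `c ∈ A` with `c ∉ ⟨q⟩`.  The doubled type `i(S) ⊔ i(S)x` of a CM half `S ⊂ A` is then DEGENERATE, and it is
PRIMITIVE iff `S` is aperiodic and `θ`-asymmetric.  So far every instance (`D₄ × C_n`, `D₈ ∕ SD₁₆ ∕ M₁₆ × C_n`, Pauli `× C_n`,
`(C₄×C₂)⋊C₂ × C_n`, `(C₄⋊C₄) × C_n`) needed its OWN half, found by hand or by machine.  THIS FILE REMOVES THE SEARCH: when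
`A = B × ℤ/n` with `n ≥ 3`, `θ = θ_B × id` and `c = (c_B, 0)`, an aperiodic `θ`-asymmetric half ALWAYS exists as soon as `θ_B ≠ id`.

§1 (combinatorics in `B`, namespace `TwoHalves`).  A CM half of `(B, c)` exists (`exists_half`: `{b : f(b) < f(c+b)}` for any
injection `f : B ↪ Fin N`).  FLIPPING a half `H` along one coset `{b₀, b₀+c}` gives a half (`flip_cm`).  If `θ ≠ id` (any map
`θ : B → B`), some half is NOT `θ`-invariant (`exists_half_not_invariant`: if `H` is invariant, flip it at a point `b₀` moved by `θ` —
invariance plus the half property give `θ b₀ ∉ {b₀, b₀ + c}`, so the flipped half contains exactly one of `b₀, θ b₀`).  For such an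
`H₁` the pair `(H₁, H₂ = H₁ Δ {0, c})` satisfies the hypotheses of the fibre lemmas of `CorCM/GaloisTwoHalvesCyclicFibres`
(`flip_ne`, `flip_stab`, `flip_refl`): a common period or a common `θ`-reflection `a` of `H₁, H₂` preserves `H₁ Δ H₂ = {0, c}`, so
`a ∈ {0, c}`; `a = c` contradicts the half property at `b = 0`, and `a = 0` is excluded resp. is the non-invariance of `H₁`
(`θ 0 = 0` is all that is used of `θ`).

§2 THE THEOREM **`exists_simple_degenerate_of_index_two_times_cyclic`**.  `K` Galois CM, `e : Gal(K/ℚ) ≃* G₀`,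
`i : B × ℤ/n ↪ G₀` (written multiplicatively) abelian of index two with `n ≥ 3`, `x i(b,v) x⁻¹ = i(θ b, v)` for an additive
automorphism `θ ≠ id` of `B`, `x² = i(q)`, complex conjugation `e(c̄) = i(c, 0)` with `(c, 0) ∉ ⟨q⟩` ⟹ `K` is BAD: a PRIMITIVE
DEGENERATE CM type, realised by a SIMPLE abelian variety of dimension `|G₀|/2` with CM by `K`, with a rational `(p,p)` class outside
the divisor ring on some power.  (`c² = 1` and `θ c = c` are READ OFF `Gal(K/ℚ)`: complex conjugation is a central involution —
`GaloisRank.model_complexConj_mul_self`, `model_complexConj_comm`.)  In words: **a CM Galois group `Γ₀ × C_n` (`n ≥ 3`), `Γ₀`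
NON-ABELIAN with an abelian subgroup `A₀ ∋ c` of index two and some `x ∉ A₀` with `c ∉ ⟨x²⟩`, is BAD** — uniformly, for every
such `Γ₀`; the embedding need not even split off the `C_n` (`q` may have a `ℤ/n`-component).  What is left of «abelian index two» is
the HARD side `c ∈ ⟨x²⟩ ∀ x ∉ A` (dicyclic `× C_n`, `C_p ⋊ C_{2^k}`, …: norm-pair arithmetic, gens 25–30) and `n ∈ {1, 2}`.

§3 FIRST COROLLARY **`exists_simple_degenerate_dihedral_times_cyclic`**: `Gal(K/ℚ) ≅ D_{2k} × C_n` (`DihedralGroup (2k)`, order `4k`,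
`k ≥ 2`, `n ≥ 3`, complex conjugation `(rᵏ, 1)`) ⟹ a simple degenerate CM abelian variety of dimension `2kn` — for EVERY `k ≥ 2`
at once (previously `k = 2, 4` for all `n`, `CorCM/GaloisDihedralTimesCyclicDegenerate`, `…SemidihedralModular…`).

## References

* [Kubota1965] T. Kubota, *On the field extension by complex multiplication*, Trans. AMS 118 (1965), §2, §4 Lemma 2.
* [Shimura1998] G. Shimura, *Abelian Varieties with Complex Multiplication and Modular Functions*, §6.2 Thm. 3, §8.2 Prop. 26.
* [Gordon1999HodgeAVSurvey] B. B. Gordon, *A survey of the Hodge conjecture for abelian varieties*, Thm. 6.4, §9.3.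
-/

noncomputable section

open CategoryTheory CategoryTheory.Limits NumberField
open scoped BigOperators symmDiff

/-! ## §1 Flips of halves -/

namespace Summit.HodgeConjecture.CorCM.TwoHalves

variable {B : Type*} [AddCommGroup B] [DecidableEq B]

omit [DecidableEq B] in
/-- **A CM half exists**: for an injection `f : B ↪ Fin N`, `{b : f b < f (c + b)}` meets every coset `{b, c + b}` (`c ≠ 0`, `2c = 0`)
exactly once. [folklore] -/
theorem exists_half [Fintype B] (c : B) (hc0 : c ≠ 0) (hcc : c + c = 0) : ∃ H : Finset B, ∀ b, b ∈ H ↔ c + b ∉ H := by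
  classical
  let f := Fintype.equivFin B
  refine ⟨Finset.univ.filter fun b => f b < f (c + b), fun b => ?_⟩
  have hcb : c + (c + b) = b := by rw [← add_assoc, hcc, zero_add]
  have hne : f (c + b) ≠ f b := fun h => hc0 (by simpa using f.injective h)
  simp only [Finset.mem_filter, Finset.mem_univ, true_and, hcb, not_lt]
  exact ⟨fun h => h.le, fun h => lt_of_le_of_ne h hne.symm⟩

/-- **Flipping one coset keeps a half a half**: `H Δ {b₀, c + b₀}`. [folklore] -/
theorem flip_cm (H : Finset B) (c : B) (hcc : c + c = 0) (hH : ∀ b, b ∈ H ↔ c + b ∉ H) (b₀ b : B) :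
    b ∈ H ∆ {b₀, c + b₀} ↔ c + b ∉ H ∆ {b₀, c + b₀} := by
  have hcb : ∀ b, c + (c + b) = b := fun b => by rw [← add_assoc, hcc, zero_add]
  have key : (c + b = b₀ ∨ c + b = c + b₀) ↔ (b = b₀ ∨ b = c + b₀) := by
    constructor
    · rintro (h | h)
      · right; rw [← h, hcb]
      · left; exact add_left_cancel h
    · rintro (h | h)
      · right; rw [h]
      · left; rw [h, hcb]
  have h2 : c + b ∈ H ↔ b ∉ H := by rw [hH (c + b), hcb]
  simp only [Finset.mem_symmDiff, Finset.mem_insert, Finset.mem_singleton, key, h2]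
  tauto

/-- **`θ ≠ id` ⟹ some CM half is not `θ`-invariant** (`θ` any self-map of `B`): if `H` is invariant, flip it along the coset of a
point `b₀` moved by `θ`. [folklore] -/
theorem exists_half_not_invariant [Fintype B] (c : B) (hc0 : c ≠ 0) (hcc : c + c = 0) (θ : B → B) {b₀ : B} (hb₀ : θ b₀ ≠ b₀) :
    ∃ H : Finset B, (∀ b, b ∈ H ↔ c + b ∉ H) ∧ ∃ b, ¬ (b ∈ H ↔ θ b ∈ H) := by
  obtain ⟨H, hH⟩ := exists_half c hc0 hcc
  by_cases hinv : ∃ b, ¬ (b ∈ H ↔ θ b ∈ H)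
  · exact ⟨H, hH, hinv⟩
  push Not at hinv
  have hθc : θ b₀ ≠ c + b₀ := fun h => by
    have h1 := hinv b₀
    rw [h] at h1
    exact iff_not_self (h1.symm.trans (hH b₀))
  refine ⟨H ∆ {b₀, c + b₀}, flip_cm H c hcc hH b₀, b₀, ?_⟩
  have h1 := hinv b₀
  simp only [Finset.mem_symmDiff, Finset.mem_insert, Finset.mem_singleton, hb₀, hθc, or_self, not_false_eq_true, and_true,
    true_or, not_true_eq_false, and_false, false_or, true_and, false_and, or_false]
  rw [← h1]
  exact not_iff_self

/-- The flipped half differs from `H`. [folklore] -/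
theorem flip_ne (H : Finset B) (c : B) : H ≠ H ∆ {0, c} := by
  intro h
  have h0 : (0 : B) ∈ H ∆ {0, c} ↔ (0 : B) ∉ H := by simp [Finset.mem_symmDiff]
  rw [← h] at h0
  exact iff_not_self h0

/-- **No common period**: a common period `a ≠ 0` of `H` and `H Δ {0, c}` preserves `{0, c}`, so `a = c` — but `c` maps a half onto
its complement. [folklore] -/
theorem flip_stab (H : Finset B) (c : B) (hH : ∀ b, b ∈ H ↔ c + b ∉ H) (a : B) (ha : a ≠ 0) :
    (∃ b, ¬ (b ∈ H ↔ a + b ∈ H)) ∨ (∃ b, ¬ (b ∈ H ∆ {0, c} ↔ a + b ∈ H ∆ {0, c})) := by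
  by_contra hcon
  push Not at hcon
  obtain ⟨h1, h2⟩ := hcon
  have key : ∀ b, (b = 0 ∨ b = c) ↔ (a + b = 0 ∨ a + b = c) := fun b => by
    have e1 := h1 b
    have e2 := h2 b
    simp only [Finset.mem_symmDiff, Finset.mem_insert, Finset.mem_singleton] at e2
    tauto
  have ha' : a = 0 ∨ a = c := by simpa using (key 0).1 (Or.inl rfl)
  rcases ha' with rfl | rfl
  · exact ha rfl
  · have e1 := h1 0
    rw [add_zero] at e1
    have e3 := hH 0
    rw [add_zero] at e3
    exact iff_not_self (e1.symm.trans e3)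

/-- **No common `θ`-reflection**: a common `a` with `a + θ(H) = H` and `a + θ(H Δ {0,c}) = H Δ {0,c}` (`θ 0 = 0`) has `a ∈ {0, c}`;
`a = 0` is excluded by the non-invariance of `H`, `a = c` by the half property at `0`. [folklore] -/
theorem flip_refl (H : Finset B) (c : B) (hH : ∀ b, b ∈ H ↔ c + b ∉ H) (θ : B → B) (hθ0 : θ 0 = 0)
    (hinv : ∃ b, ¬ (b ∈ H ↔ θ b ∈ H)) (a : B) :
    (∃ b, ¬ (b ∈ H ↔ a + θ b ∈ H)) ∨ (∃ b, ¬ (b ∈ H ∆ {0, c} ↔ a + θ b ∈ H ∆ {0, c})) := by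
  by_contra hcon
  push Not at hcon
  obtain ⟨h1, h2⟩ := hcon
  have key : ∀ b, (b = 0 ∨ b = c) ↔ (a + θ b = 0 ∨ a + θ b = c) := fun b => by
    have e1 := h1 b
    have e2 := h2 b
    simp only [Finset.mem_symmDiff, Finset.mem_insert, Finset.mem_singleton] at e2
    tauto
  have ha' : a = 0 ∨ a = c := by simpa [hθ0] using (key 0).1 (Or.inl rfl)
  rcases ha' with rfl | rfl
  · obtain ⟨b, hb⟩ := hinv
    exact hb (by simpa using h1 b)
  · have e1 := h1 0
    rw [hθ0, add_zero] at e1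
    have e3 := hH 0
    rw [add_zero] at e3
    exact iff_not_self (e1.symm.trans e3)

end Summit.HodgeConjecture.CorCM.TwoHalves

/-! ## §2 The theorem -/

namespace Summit.HodgeConjecture.CorCM.SplitInvolution

open Literature.NumberTheory.ComplexMultiplication
open Literature.AlgebraicGeometry.Motives (AbelianVariety CMType)
open Literature.AlgebraicGeometry.HodgeTheory
open Literature.AlgebraicGeometry.ComplexMultiplication (IsCMTypeRealisation)
open Literature.AlgebraicGeometry.Pohlmann1968
open Literature.Barriers.HodgeConjecture (divisorClassesSpan)
open Summit.HodgeConjecture.CorCM.GaloisRank (model_complexConj_mul_self model_complexConj_comm)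

section Field

variable {G₀ : Type*} [Group G₀] [Fintype G₀] [DecidableEq G₀]
variable {B : Type*} [AddCommGroup B] [Fintype B] [DecidableEq B]
variable {K : Type} [Field K] [NumberField K] [IsCMField K] [IsGalois ℚ K]

/-- **THE EASY HALF OF THE INDEX-TWO DICHOTOMY, ALL DEGREES.**  `K` a Galois CM field, `e : Gal(K/ℚ) ≃* G₀`;
`i : B × ℤ/n ↪ G₀` (multiplicative notation) abelian of index two, `G₀ = i(A) ⊔ i(A)x`, with `n ≥ 3`; `x i(b, v) = i(θ b, v) x` for an
additive automorphism `θ` of `B` which is NOT the identity; `x² = i(q)`; complex conjugation `e(c̄) = i(c, 0)` with `(c, 0) ∉ ⟨q⟩`.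
THEN `K` has a PRIMITIVE DEGENERATE CM type, realised by a SIMPLE abelian variety of dimension `|G₀|/2` with CM by `K` carrying a
rational `(p,p)` class outside the divisor ring on some power.  (The aperiodic `θ`-asymmetric half is the two-halves fibre half of a
non-`θ`-invariant half `H₁` of `B` and its flip `H₁ Δ {0, c}`; no search.)
[cite: Kubota1965, §2 and §4 Lemma 2] [cite: Shimura1998, §6.2 Thm. 3 and §8.2 Prop. 26] [cite: Gordon1999HodgeAVSurvey, Thm. 6.4 and §9.3] -/
theorem exists_simple_degenerate_of_index_two_times_cyclic {n : ℕ} [NeZero n] (hn : 3 ≤ n) (e : (K ≃ₐ[ℚ] K) ≃* G₀)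
    (i : Multiplicative B × Multiplicative (ZMod n) →* G₀) (hi : Function.Injective i)
    (x : G₀) (hx : ∀ u, i u ≠ x) (hcov : ∀ g : G₀, (∃ u, g = i u) ∨ (∃ u, g = i u * x))
    (θ : B ≃+ B) (hθ : ∀ (b : B) (v : Multiplicative (ZMod n)),
      x * i (Multiplicative.ofAdd b, v) = i (Multiplicative.ofAdd (θ b), v) * x)
    (hθ1 : ∃ b, θ b ≠ b) (q : Multiplicative B × Multiplicative (ZMod n)) (hq : x * x = i q) (c : B)
    (hcq : (Multiplicative.ofAdd c, (1 : Multiplicative (ZMod n))) ∉ Subgroup.zpowers q)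
    (hc : e ((IsCMField.complexConj K).restrictScalars ℚ) = i (Multiplicative.ofAdd c, 1)) :
    ∃ (Φ : CMType K) (φ₀ : K →+* ℂ) (X : AbelianVariety ℂ) (ι : 𝓞 K →+* End X)
      (ϑ : K →+* Module.End ℂ (complexBetti X.X 1)),
      IsPrimitive (ℂ ≃+* ℂ) Φ.1 φ₀ ∧ ¬ IsNondegenerate Φ ∧ IsCMTypeRealisation Φ X ι ϑ ∧ X.IsSimple ∧
      X.dim = Fintype.card G₀ / 2 ∧
      ∃ m p : ℕ, ∃ y : complexBetti (⨁ fun _ : Fin m => X).X (2 * p), IsRationalClass y ∧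
        IsOfHodgeType (⨁ fun _ : Fin m => X).dim (⨁ fun _ : Fin m => X).X (2 * p) p p y ∧
        y ∉ divisorClassesSpan (⨁ fun _ : Fin m => X).X (⨁ fun _ : Fin m => X).dim p := by
  classical
  set cA : Multiplicative B × Multiplicative (ZMod n) := (Multiplicative.ofAdd c, 1) with hcA_def
  -- `c² = 1` and `θ c = c`, read off `Gal(K/ℚ)`
  have hccA : cA * cA = 1 := hi (by rw [map_mul, map_one]; exact model_complexConj_mul_self e hc)
  have hcc : c + c = 0 := by
    have h := congrArg (fun w => Multiplicative.toAdd w.1) hccA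
    simpa [hcA_def] using h
  have hc0 : c ≠ 0 := by
    rintro rfl
    exact hcq (by rw [hcA_def, ofAdd_zero, ← Prod.one_eq_mk]; exact one_mem _)
  let θA : Multiplicative B × Multiplicative (ZMod n) ≃* Multiplicative B × Multiplicative (ZMod n) :=
    MulEquiv.prodCongr (AddEquiv.toMultiplicative θ) (MulEquiv.refl _)
  have hθA_apply : ∀ w, θA w = (Multiplicative.ofAdd (θ (Multiplicative.toAdd w.1)), w.2) := fun w => rfl
  have hθ' : ∀ u, x * i u = i (θA u) * x := fun ⟨u, v⟩ => by
    rw [hθA_apply, ← hθ, ofAdd_toAdd]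
  have hθc : θ c = c := by
    have h1 : i cA * x = i (θA cA) * x := by rw [← hθ', model_complexConj_comm e hc x]
    have h2 := congrArg (fun w => Multiplicative.toAdd w.1) (hi (mul_right_cancel h1))
    simpa [hcA_def, hθA_apply] using h2.symm
  have hθAc : θA cA = cA := by rw [hθA_apply, hcA_def, toAdd_ofAdd, hθc]
  -- the pair of halves of `B`
  obtain ⟨b₀, hb₀⟩ := hθ1
  obtain ⟨H₁, h₁, hinv⟩ := TwoHalves.exists_half_not_invariant c hc0 hcc θ hb₀
  set H₂ : Finset B := H₁ ∆ {0, c} with hH₂_def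
  have h₂ : ∀ b, b ∈ H₂ ↔ c + b ∉ H₂ := fun b => by
    have h := TwoHalves.flip_cm H₁ c hcc h₁ 0 b
    rwa [add_zero] at h
  have hne : H₁ ≠ H₂ := TwoHalves.flip_ne H₁ c
  have hstab : ∀ a : B, a ≠ 0 → (∃ b, ¬ (b ∈ H₁ ↔ a + b ∈ H₁)) ∨ (∃ b, ¬ (b ∈ H₂ ↔ a + b ∈ H₂)) :=
    TwoHalves.flip_stab H₁ c h₁
  have hR : ∀ a : B, (∃ b, ¬ (b ∈ H₁ ↔ a + θ b ∈ H₁)) ∨ (∃ b, ¬ (b ∈ H₂ ↔ a + θ b ∈ H₂)) :=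
    TwoHalves.flip_refl H₁ c h₁ θ (map_zero θ) hinv
  -- the fibre half of `A = B × ℤ/n`
  set S : Finset (Multiplicative B × Multiplicative (ZMod n)) := Finset.univ.filter fun w =>
    if Multiplicative.toAdd w.2 = 1 then Multiplicative.toAdd w.1 ∈ H₂ else Multiplicative.toAdd w.1 ∈ H₁ with hS_def
  have hSmem : ∀ w : Multiplicative B × Multiplicative (ZMod n),
      w ∈ S ↔ (if Multiplicative.toAdd w.2 = 1 then Multiplicative.toAdd w.1 ∈ H₂ else Multiplicative.toAdd w.1 ∈ H₁) :=
    fun w => by simp [hS_def]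
  have hS : ∀ a, a ∈ S ↔ cA * a ∉ S := fun ⟨a, v⟩ => by
    have h := TwoHalves.fibre_cm H₁ H₂ c h₁ h₂ (Multiplicative.toAdd a, Multiplicative.toAdd v)
    simp only [Prod.mk_add_mk, zero_add] at h
    simpa only [hSmem, hcA_def, Prod.mk_mul_mk, one_mul, toAdd_mul, toAdd_ofAdd] using h
  have haper : ∀ a : Multiplicative B × Multiplicative (ZMod n), a ≠ 1 → ∃ s, ¬ (s ∈ S ↔ a * s ∈ S) := by
    rintro ⟨a, v⟩ ha
    have ha' : (Multiplicative.toAdd a, Multiplicative.toAdd v) ≠ (0 : B × ZMod n) := by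
      intro h
      apply ha
      rw [Prod.mk_eq_zero] at h
      exact Prod.ext (toAdd_eq_zero.1 h.1) (toAdd_eq_zero.1 h.2)
    obtain ⟨⟨s₁, s₂⟩, hs⟩ := TwoHalves.fibre_aperiodic hn H₁ H₂ hne hstab _ ha'
    refine ⟨(Multiplicative.ofAdd s₁, Multiplicative.ofAdd s₂), ?_⟩
    simpa only [hSmem, Prod.mk_mul_mk, toAdd_mul, toAdd_ofAdd, Prod.mk_add_mk] using hs
  have hasym : ∀ a : Multiplicative B × Multiplicative (ZMod n), ∃ s, ¬ (s ∈ S ↔ a * θA s ∈ S) := by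
    rintro ⟨a, v⟩
    obtain ⟨⟨s₁, s₂⟩, hs⟩ := TwoHalves.fibre_asymmetric hn θ θ.surjective H₁ H₂ hne hR
      (Multiplicative.toAdd a, Multiplicative.toAdd v)
    refine ⟨(Multiplicative.ofAdd s₁, Multiplicative.ofAdd s₂), ?_⟩
    simpa only [hSmem, hθA_apply, Prod.mk_mul_mk, toAdd_mul, toAdd_ofAdd, Prod.mk_add_mk] using hs
  exact exists_simple_degenerate_of_index_two_doubled e i hi x hx hcov θA hθ' q hq hcq hccA hθAc hc S hS haper hasym

/-! ## §3 First corollary: every dihedral group of order `4k ≥ 8`, times `C_n` (`n ≥ 3`) -/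

/-- **`Gal(K/ℚ) ≅ D_{2k} × C_n` (`DihedralGroup (2k)` of order `4k`, `k ≥ 2`, `n ≥ 3`), complex conjugation `(rᵏ, 1)` ⟹ BAD**: a
simple DEGENERATE abelian variety of dimension `2kn` with CM by `K` (exceptional Hodge class on some power) — `A = ⟨r⟩ × C_n`,
`x = (s, 1)`, `x² = 1 ∌ rᵏ`, `θ = −1 ≠ id` on `ℤ/2k`. [cite: Kubota1965, §2 and §4 Lemma 2]
[cite: Shimura1998, §6.2 Thm. 3 and §8.2 Prop. 26] [cite: Gordon1999HodgeAVSurvey, Thm. 6.4 and §9.3] -/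
theorem exists_simple_degenerate_dihedral_times_cyclic {k n : ℕ} [NeZero k] [NeZero n] (hk : 2 ≤ k) (hn : 3 ≤ n)
    (e : (K ≃ₐ[ℚ] K) ≃* DihedralGroup (2 * k) × Multiplicative (ZMod n))
    (hc : e ((IsCMField.complexConj K).restrictScalars ℚ) = (DihedralGroup.r k, 1)) :
    ∃ (Φ : CMType K) (φ₀ : K →+* ℂ) (X : AbelianVariety ℂ) (ι : 𝓞 K →+* End X)
      (ϑ : K →+* Module.End ℂ (complexBetti X.X 1)),
      IsPrimitive (ℂ ≃+* ℂ) Φ.1 φ₀ ∧ ¬ IsNondegenerate Φ ∧ IsCMTypeRealisation Φ X ι ϑ ∧ X.IsSimple ∧ X.dim = 2 * k * n ∧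
      ∃ m p : ℕ, ∃ y : complexBetti (⨁ fun _ : Fin m => X).X (2 * p), IsRationalClass y ∧
        IsOfHodgeType (⨁ fun _ : Fin m => X).dim (⨁ fun _ : Fin m => X).X (2 * p) p p y ∧
        y ∉ divisorClassesSpan (⨁ fun _ : Fin m => X).X (⨁ fun _ : Fin m => X).dim p := by
  classical
  haveI : NeZero (2 * k) := ⟨by have := NeZero.ne k; omega⟩
  let i₁ : Multiplicative (ZMod (2 * k)) →* DihedralGroup (2 * k) :=
    MonoidHom.mk' (fun u => DihedralGroup.r (Multiplicative.toAdd u)) fun u v => by simp [toAdd_mul]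
  let i : Multiplicative (ZMod (2 * k)) × Multiplicative (ZMod n) →* DihedralGroup (2 * k) × Multiplicative (ZMod n) :=
    MonoidHom.prodMap i₁ (MonoidHom.id _)
  have hi_apply : ∀ u v, i (u, v) = (DihedralGroup.r (Multiplicative.toAdd u), v) := fun u v => rfl
  have hi : Function.Injective i := by
    rintro ⟨u, v⟩ ⟨u', v'⟩ h
    simp only [hi_apply, Prod.mk.injEq, DihedralGroup.r.injEq] at h
    exact Prod.ext (by simpa using h.1) h.2
  set x : DihedralGroup (2 * k) × Multiplicative (ZMod n) := (DihedralGroup.sr 0, 1) with hx_def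
  have hx : ∀ w, i w ≠ x := fun ⟨u, v⟩ => by simp [hi_apply, hx_def]
  have hcov : ∀ g : DihedralGroup (2 * k) × Multiplicative (ZMod n), (∃ w, g = i w) ∨ (∃ w, g = i w * x) := by
    rintro ⟨j | j, v⟩
    · exact Or.inl ⟨(Multiplicative.ofAdd j, v), by simp [hi_apply]⟩
    · exact Or.inr ⟨(Multiplicative.ofAdd (-j), v), by simp [hi_apply, hx_def]⟩
  have hθ : ∀ (b : ZMod (2 * k)) (v : Multiplicative (ZMod n)),
      x * i (Multiplicative.ofAdd b, v) = i (Multiplicative.ofAdd ((AddEquiv.neg (ZMod (2 * k))) b), v) * x := fun b v => by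
    simp [hi_apply, hx_def]
  have h2 : (2 : ZMod (2 * k)) ≠ 0 := by
    intro h
    have : ((2 : ℕ) : ZMod (2 * k)) = 0 := by exact_mod_cast h
    rw [ZMod.natCast_eq_zero_iff] at this
    exact absurd (Nat.le_of_dvd (by norm_num) this) (by omega)
  have hθ1 : ∃ b : ZMod (2 * k), (AddEquiv.neg (ZMod (2 * k))) b ≠ b :=
    ⟨1, fun h => h2 (by rw [AddEquiv.neg_apply] at h; linear_combination -h)⟩
  have hq : x * x = i 1 := by rw [map_one, hx_def, Prod.mk_mul_mk, mul_one, DihedralGroup.sr_mul_sr, sub_self]; rfl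
  have hk0 : ((k : ℕ) : ZMod (2 * k)) ≠ 0 := by
    rw [Ne, ZMod.natCast_eq_zero_iff]
    intro h
    exact absurd (Nat.le_of_dvd (by have := NeZero.ne k; omega) h) (by omega)
  have hcq : (Multiplicative.ofAdd ((k : ℕ) : ZMod (2 * k)), (1 : Multiplicative (ZMod n))) ∉
      Subgroup.zpowers (1 : Multiplicative (ZMod (2 * k)) × Multiplicative (ZMod n)) := by
    rw [Subgroup.zpowers_one_eq_bot, Subgroup.mem_bot, Prod.mk_eq_one]
    exact fun h => hk0 (by simpa using congrArg Multiplicative.toAdd h.1)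
  have hic : i (Multiplicative.ofAdd ((k : ℕ) : ZMod (2 * k)), 1) = (DihedralGroup.r k, 1) := rfl
  obtain ⟨Φ, φ₀, X, ι, ϑ, h1, h2', h3, h4, h5, h6⟩ := exists_simple_degenerate_of_index_two_times_cyclic hn e i hi x hx hcov
    (AddEquiv.neg (ZMod (2 * k))) hθ hθ1 1 hq ((k : ℕ) : ZMod (2 * k)) hcq (by rw [hic]; exact hc)
  refine ⟨Φ, φ₀, X, ι, ϑ, h1, h2', h3, h4, ?_, h6⟩
  rw [h5, Fintype.card_prod, Fintype.card_multiplicative, ZMod.card, DihedralGroup.card, Nat.mul_assoc,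
    Nat.mul_div_cancel_left _ Nat.two_pos]

end Field

end Summit.HodgeConjecture.CorCM.SplitInvolution

end
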